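import Literature.NumberTheory.ComplexMultiplication.EllipticUnits.ImaginaryQuadraticMainConjectureCarriers
import Literature.NumberTheory.GaloisRepresentations.ContinuousH1FiniteOfBoundedIndex
import Literature.NumberTheory.GaloisRepresentations.GlobalPFinitenessProofs
import HarnessLib

/-!
# M-LINE-PIN / (α3) ROW 2, FILE 3f: the level groups `H¹(G_S(F), μ_{p^k} ⊗ θ)` are FINITE

Cell `bsd-print-cf2`, WIDTH seat `bsd-line-cf2-p1-w6` g8 (prover-bsd-line-cf2-p1-w6-g8-0); (α3) ROW 2 on the DECIDING child stmt-BirchSwinnertonDyer-24721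
(memo `HOME/bsd-line-cf2-p1-w6/ROW2-SPEC-w6g8.md`; the Kőnig input `[∀ n k, Finite (L n k)]` of `RowTwo.exists_lift` for `L n k = layerCoh … n k 1`);
`--supports` that item (helper, Theses-free). HONEST FRAMING: a finiteness bookkeeping lemma; nothing about BSD. THEOREMS ONLY.

* `finite_setOf_isOpen_index_le_imGS` — an open subgroup `U_S ≤ G_S` is of type (F) (finitely many open subgroups of each bounded index),
  because `G_S` is (Hermite, the tree's `finite_setOf_isOpen_index_le_galoisGroupUnramifiedOutside`) and `V ↦ V` raises the index by `[G_S : U_S]`.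
* `finite_levelCoh_one` — `H¹(U_S, (μ_{p^k} ⊗ θ)^{N_S})` is finite for `S` finite and `U` open (Serre III §4.1 Prop. 8 via the tree's
  `ContinuousRep.finite_continuousCohomology_one`).
* `suppPF_finite`, `finite_layerCoh_one` — the layer groups of ty2's `ℤ_p²`-tower at `S = {v ∣ p𝔣}`, `𝔣 ≠ 0`.

References: J.-P. Serre, *Galois Cohomology* III §4.1 Prop. 8; B. Mazur (1989) §1.2 (Hermite ⟹ Φ_p for `G_{K,S}`).
-/

noncomputable section

set_option autoImplicit false

open scoped NumberField
open Field IsDedekindDomain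
open Literature.NumberTheory.GaloisRepresentations Literature.NumberTheory.GaloisRepresentations.DiscreteGaloisModule
open Literature.NumberTheory.ComplexMultiplication.EllipticUnits.JohnsonLeungKings2011

-- the summit namespace `Summit.BirchSwinnertonDyer.BirchSwinnertonDyer` repeats the problem name by design (D-0017)
set_option linter.dupNamespace false

namespace Summit.BirchSwinnertonDyer.BirchSwinnertonDyer.Theorems.PrintCf2.RowTwo

variable {K : Type} [Field K] [NumberField K] (p : ℕ) [Fact p.Prime] (S : Set (HeightOneSpectrum (𝓞 K)))
  (θ : absoluteGaloisGroup K →ₜ* ℤ_[p]ˣ)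

/-- **An open subgroup `U_S` of `G_S` is of type (F)**: for `S` finite and `U ≤ Γ_K` open, `U_S = imGS S U` has finitely many open subgroups
of index `≤ n` for every `n` (they are open subgroups of `G_S` of index `≤ n·[G_S : U_S]`, finitely many by Hermite).
[cite: SerreGaloisCohomology1997, Ch. III §4.1 (type (F))] [cite: Mazur1989Deforming, §1.2] -/
theorem finite_setOf_isOpen_index_le_imGS (hS : S.Finite) {U : Subgroup (absoluteGaloisGroup K)}
    (hU : IsOpen (U : Set (absoluteGaloisGroup K))) (n : ℕ) :
    {V : Subgroup (imGS S U) | IsOpen (V : Set (imGS S U)) ∧ V.index ≤ n}.Finite := by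
  have hUo : IsOpen (imGS S U : Set (GaloisGroupUnramifiedOutside K S)) := isOpenMap_toUnramifiedQuot K S _ hU
  refine Set.Finite.of_finite_image (f := Subgroup.map (imGS S U).subtype)
    ((finite_setOf_isOpen_index_le_galoisGroupUnramifiedOutside K hS (n * (imGS S U).index)).subset ?_)
    (Subgroup.map_injective (imGS S U).subtype_injective).injOn
  rintro _ ⟨V, ⟨hVo, hVi⟩, rfl⟩
  refine ⟨?_, ?_⟩
  · rw [Subgroup.coe_map, Subgroup.coe_subtype]
    exact hUo.isOpenMap_subtype_val _ hVo
  · rw [Subgroup.index_map_subtype]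
    exact Nat.mul_le_mul_right _ hVi

/-- **`H¹(G_S(F), (μ_{p^k} ⊗ θ)^{N_S})` is finite** (`F = K̄^U`, `U` open, `S` finite): a finite discrete module over the compact group `U_S` of type
(F) (Serre III §4.1 Prop. 8, the tree's `ContinuousRep.finite_continuousCohomology_one`). [cite: SerreGaloisCohomology1997, Ch. III §4.1, Prop. 8]
[cite: JohnsonLeungKings2011, Def. 4.2 (94) (arXiv p0012:L94)] -/
theorem finite_levelCoh_one (hS : S.Finite) {U : Subgroup (absoluteGaloisGroup K)} (hU : IsOpen (U : Set (absoluteGaloisGroup K)))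
    (k : ℕ) : Finite (levelCoh p S θ U k 1) := by
  haveI : CompactSpace (imGS S U) :=
    isCompact_iff_compactSpace.mp (Subgroup.isClosed_of_isOpen _ (isOpenMap_toUnramifiedQuot K S _ hU)).isCompact
  haveI : NeZero (p ^ k) := ⟨pow_ne_zero _ (Fact.out : p.Prime).ne_zero⟩
  haveI : Finite (MuCarrier K (p ^ k)) := inferInstanceAs (Finite (Additive (rootsOfUnity (p ^ k) (AlgebraicClosure K))))
  exact (levelRep p S θ U k).finite_continuousCohomology_one (finite_setOf_isOpen_index_le_imGS S hS hU)

/-- `S = {v ∣ p𝔣}` is finite for `𝔣 ≠ 0`. [cite: JohnsonLeungKings2011, Cor. 5.3 (arXiv p0015:L1–3)] -/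
theorem suppPF_finite {𝔣 : Ideal (𝓞 K)} (h𝔣 : 𝔣 ≠ ⊥) : (suppPF p 𝔣 : Set (HeightOneSpectrum (𝓞 K))).Finite := by
  have hp : Ideal.span {((p : ℕ) : 𝓞 K)} ≠ ⊥ := by
    rw [Ne, Ideal.span_singleton_eq_bot]
    exact_mod_cast (Fact.out : p.Prime).ne_zero
  exact Ideal.finite_factors (mul_ne_zero hp h𝔣)

/-- **The layer groups `H¹(G_S(K̃_n), μ_{p^k} ⊗ θ)` of the `ℤ_p²`-tower are finite** (`𝔣 ≠ 0`) — the Kőnig input of the ROW-2 lift.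
[cite: JohnsonLeungKings2011, Def. 4.2 (94) and Cor. 5.3 (arXiv p0012:L94, p0015:L1–20)] [cite: SerreGaloisCohomology1997, Ch. III §4.1, Prop. 8] -/
theorem finite_layerCoh_one (κ₁ κ₂ : Literature.NumberTheory.EllipticCurves.ZpExtension K p) {𝔣 : Ideal (𝓞 K)} (h𝔣 : 𝔣 ≠ ⊥) (n k : ℕ) :
    Finite (layerCoh p κ₁ κ₂ θ 𝔣 n k 1) :=
  finite_levelCoh_one p (suppPF p 𝔣) θ (suppPF_finite p h𝔣) (isOpen_pairLayerSubgroup κ₁ κ₂ n) k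

end Summit.BirchSwinnertonDyer.BirchSwinnertonDyer.Theorems.PrintCf2.RowTwo

end
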